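import Summits.BirchSwinnertonDyer.Rank1Residual.Additive.RamifiedSevenGenusSemilocalKernel
import HarnessLib

set_option autoImplicit false

/-!
# `𝒞₇` genus road (crux `EllipticUnitValueSevenOfGZK`, K7r), the (5)-unit programme (SUMMON GENUS-UNIT-A6), File E4a:
# THE PUSHED TWISTED UNIT — the element `V = 2·(48θraw) + Σ_g Y(g)·υ_g(1+T)^{r_n(ḡ)}(48ξraw)` of Tsuji's `𝓤` whose level-`n`
# projection is `wₙ^{48}`, the vanishing `rep n (V + υ_c(1+T)^{j}V) = 1` from (A6-2)'s `wₙ·c(wₙ) = 1`, and its `e_{η₁}`-image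
# `48·(2·e_{η₁}θ + Pₙ·e_{η₁}ξ)` (THEOREMS ONLY)

Cell bsd-cm, seat bsd-cm-k-ty1 g27 (literature-prover); SUMMON `wake/SUMMON-bsd-cm-k-ty1-20260830T2140Z.md` (planner g36,
D972) block (A6-3) = File E, LAST brick, first half (module-side bookkeeping for E4b `RamifiedSevenGenusUnitSideIdentityOfPin`).

* §1 algebra helpers: `zpow_finset_sum`, `finprod_zpow_finsum_fiber_eq_prod` (`∏ᶠ_h f(h)^{Σ_{T g = h} Y g} = ∏_g f(T g)^{Y g}`),
  `isUnit_ninetySix`, `coe_zpow_intermediateField`, `toAlgEquiv_symm_smul`, `map_sq_mul_prod_zpow`,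
  `pow_sq_mul_prod_pow_zpow`, `zsmul_smul_nsmul_eq`, `nsmul_nsmul_eq`.
* §2 on the frame: `level_sub_one_coprime`, `reading_level_sub_one` (`χ_D(mₙ−1)ω(mₙ−1)⁵ = 1`: `η₁` is even),
  `one_add_X_pow_r_level_sub_one_sub_one_mem` (`(1+T)^{r_n(mₙ−1)} ≡ 1 (mod h_n)`), ★ `rep_pushedTwistedUnit_eq_one` (for lifts
  `υ_g·γ₀^{r_n(ḡ)}` of a transport `σ_g` and `υ_c·γ₀^{j}` of a complex conjugation `c` agreeing on `F′ₙ`, and the core identity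
  `wₙ·c(wₙ) = 1` of (A6-2): `rep n (V + υ_c(1+T)^{j}V) = 1` — E2 `rep_act_one_add_X_pow_smul_eq_of_agree`, (R), (I) at level `n`),
  `apply_pushedElement_eq` (`e V = 48·(2·e_{η₁}θ + (Σ_g C(Y g)·R_n(ḡ))·e_{η₁}ξ)` for E1's readings `η₁(υ_g) = χ_D(ḡ)ω(ḡ)⁵`; E2
  `apply_act_one_add_X_pow_smul_of_eq`).

HONEST LABEL: module bookkeeping; no definition, no named fact, no instance; nothing closes; stmt-BirchSwinnertonDyer-19945
OPEN; K1ᵘ NOT proved here (E4b assembles); `X12.CMRamifiedSeven` NOT proved; no summit statement is proved by this seat;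
BSD is claimed for no curve.

## References
* T. Tsuji, J. Number Theory 78 (1999) §2 Lemma 2.1, §3 (pp. 3–6), §6 (p. 20) [Tsuji1999]; K. Kato, Astérisque 295 (2004) §15.5
  (15.5.1) (p. 253) [Kato2004Asterisque]; S. Lang, *Cyclotomic Fields I–II* (1990) Ch. 10 §1–§2 (PDF pp. 167–171) [Lang1990];
  L. Washington, *Introduction to Cyclotomic Fields* (1997) §6.2 [Washington1997]; K. Rubin, Invent. Math. 103 (1991) §4 [Rubin1991].
* Tree: E1 `RamifiedSevenGenusTowerLifts`, E2 `RamifiedSevenGenusSemilocalKernel` (this seat), `RamifiedSevenGenusFactorisationShape`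
  (`GenusDatum`), `IwasawaTheory/StickelbergerSeriesExistence` (`one_add_X_pow_sub_pow_mem_of_congr`).
-/

noncomputable section

open scoped NumberField ComplexConjugate NumberTheorySymbols
open PowerSeries IsDedekindDomain Field
open Literature.NumberTheory.EllipticCurves
open Literature.NumberTheory.EllipticCurves.IwasawaAlgebra
open Literature.NumberTheory.IwasawaTheory
open Literature.NumberTheory.IwasawaTheory.StickelbergerSeries
open Literature.NumberTheory.IwasawaTheory.CyclotomicUnits (sinnottNorm)
open Literature.NumberTheory.QuadraticFields (jacobiChar jacobiChar_natCast)
open Literature.NumberTheory.ComplexMultiplication.EllipticUnits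
open Literature.NumberTheory.NumberFields
open Literature.NumberTheory.GaloisRepresentations
open Summit.BirchSwinnertonDyer.BirchSwinnertonDyer.Theorems.PrintCf2.LeopoldtAtV
  (galUnits_mem_globalUnitsOf galTranslate_globalToSemilocalUnits)

namespace Summit.BirchSwinnertonDyer.Rank1Residual.Additive.GenusSeven

/-! ## §1 Algebra helpers -/

/-- `a^{Σ_i f i} = ∏_i a^{f i}` for integer exponents in a commutative group. [folklore] -/
theorem zpow_finset_sum {G : Type*} [CommGroup G] {ι : Type*} (a : G) (s : Finset ι) (f : ι → ℤ) :
    a ^ (∑ i ∈ s, f i) = ∏ i ∈ s, a ^ f i := by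
  classical
  induction s using Finset.induction_on with
  | empty => rw [Finset.sum_empty, Finset.prod_empty, zpow_zero]
  | @insert i s hi ih => rw [Finset.sum_insert hi, Finset.prod_insert hi, zpow_add, ih]

/-- **Fibre sums as exponents**: in a field, for `T : G → Γ` between finite types, integer exponents `Y` and non-zero `f`,
`∏ᶠ_h f(h)^{Σᶠ_{g, T g = h} Y g} = ∏_g f(T g)^{Y g}` (the passage between (A6-2)'s fibre-indexed twisted unit and its
`g`-indexed form). [cite: Washington1997, §6.2 (Stickelberger element, reindexing by Gal)] -/
theorem finprod_zpow_finsum_fiber_eq_prod {L : Type*} [Field L] {G Γ : Type*} [Fintype G] [Finite Γ] [DecidableEq Γ]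
    (T : G → Γ) (f : Γ → L) (hf : ∀ h, f h ≠ 0) (Y : G → ℤ) :
    ∏ᶠ h : Γ, f h ^ (∑ᶠ (g : G) (_ : T g = h), Y g) = ∏ g : G, f (T g) ^ Y g := by
  classical
  haveI : Fintype Γ := Fintype.ofFinite Γ
  rw [finprod_eq_prod_of_fintype]
  have hfib : ∀ h : Γ, (∑ᶠ (g : G) (_ : T g = h), Y g) = ∑ g ∈ Finset.univ.filter (fun g => T g = h), Y g :=
    fun h => finsum_cond_eq_sum_of_cond_iff Y (fun {g} _ => by simp)
  simp_rw [hfib]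
  rw [← Finset.prod_fiberwise Finset.univ T (fun g => f (T g) ^ Y g)]
  refine Finset.prod_congr rfl fun h _ => ?_
  -- `f h ^ Σ = ∏ f h ^ Y g`, and on the fibre `f (T g) = f h`
  have hu : f h = ((Units.mk0 (f h) (hf h) : Lˣ) : L) := rfl
  rw [hu, ← Units.val_zpow_eq_zpow_val, zpow_finset_sum, Units.coe_prod]
  refine Finset.prod_congr rfl fun g hg => ?_
  rw [Finset.mem_filter] at hg
  rw [Units.val_zpow_eq_zpow_val, ← hu, hg.2]

/-- `96 ∈ ℤ₇ˣ`. [cite: Lang1990, Ch. 10 §1 (PDF p. 167)] -/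
theorem isUnit_ninetySix : IsUnit ((96 : ℕ) : ℤ_[7]) := by
  rw [PadicInt.isUnit_iff]
  have h1 : ‖((96 : ℕ) : ℤ_[7])‖ ≤ 1 := PadicInt.norm_le_one _
  have h2 : ¬ ‖((96 : ℕ) : ℤ_[7])‖ < 1 := by
    rw [← Int.cast_natCast, PadicInt.norm_int_lt_one_iff_dvd]; decide
  exact le_antisymm h1 (not_lt.mp h2)

/-! ## §2 On the frame: the lift of complex conjugation reads trivially; the pushed twisted unit -/

/-- Integer powers commute with the inclusion `F′ₙ ⊆ ℚ̄`. [folklore] -/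
theorem coe_zpow_intermediateField (E : IntermediateField ℚ (AlgebraicClosure ℚ)) (x : E) (k : ℤ) :
    ((x ^ k : E) : AlgebraicClosure ℚ) = (x : AlgebraicClosure ℚ) ^ k := rfl

/-- The action of `Gal(ℚ̄/ℚ)` on `ℚ̄` through `toAlgEquiv⁻¹` is application (the tree's `toAlgEquiv_symm_apply`, restated so
that the automorphism keeps the elaborated type of this file). [folklore] -/
theorem toAlgEquiv_symm_smul (τ : AlgebraicClosure ℚ ≃ₐ[ℚ] AlgebraicClosure ℚ) (x : AlgebraicClosure ℚ) :
    ((absoluteGaloisGroup.toAlgEquiv ℚ).symm τ) • x = τ x := rfl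

/-- A homomorphism of commutative groups on `a²·∏ᵢ fᵢ^{Yᵢ}`. [folklore] -/
theorem map_sq_mul_prod_zpow {H G ι : Type*} [CommGroup H] [CommGroup G] [Fintype ι] (φ : H →* G) (a : H)
    (f : ι → H) (Y : ι → ℤ) : φ (a ^ 2 * ∏ i, f i ^ Y i) = φ a ^ 2 * ∏ i, φ (f i) ^ Y i := by
  rw [map_mul, map_pow, map_prod]
  simp_rw [map_zpow]

/-- `(aᵏ)²·∏ᵢ (fᵢᵏ)^{Yᵢ} = (a²·∏ᵢ fᵢ^{Yᵢ})ᵏ` in a commutative group. [folklore] -/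
theorem pow_sq_mul_prod_pow_zpow {G ι : Type*} [CommGroup G] [Fintype ι] (a : G) (f : ι → G) (Y : ι → ℤ) (k : ℕ) :
    (a ^ k) ^ 2 * ∏ i, (f i ^ k) ^ Y i = (a ^ 2 * ∏ i, f i ^ Y i) ^ k := by
  rw [mul_pow, ← pow_mul, ← pow_mul, mul_comm k 2, ← Finset.prod_pow]
  congr 1
  refine Finset.prod_congr rfl fun i _ => ?_
  rw [← zpow_natCast, ← zpow_mul, ← zpow_natCast, ← zpow_mul, mul_comm]

/-- `z • (r • (k • x)) = (z·r·k) • x` (integer, ring and natural scalars collected in the ring). [folklore] -/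
theorem zsmul_smul_nsmul_eq {R M : Type*} [Ring R] [AddCommGroup M] [Module R M] (z : ℤ) (r : R) (k : ℕ) (x : M) :
    z • (r • (k • x)) = ((z : R) * r * k) • x := by
  rw [← Nat.cast_smul_eq_nsmul R, smul_smul, ← Int.cast_smul_eq_zsmul R, smul_smul, mul_assoc]

/-- `a • (b • x) = (a·b) • x` for natural scalars read in the ring. [folklore] -/
theorem nsmul_nsmul_eq {R M : Type*} [Ring R] [AddCommGroup M] [Module R M] (a b : ℕ) (x : M) :
    a • (b • x) = ((a : R) * b) • x := by
  rw [← Nat.cast_smul_eq_nsmul R, ← Nat.cast_smul_eq_nsmul R b, smul_smul]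

namespace GenusFrame

variable (F : GenusFrame)

/-- `mₙ − 1` is prime to `7|D|` (`7|D| ∣ mₙ`). [cite: Lang1990, Ch. 10 §1 (PDF p. 167)] -/
theorem level_sub_one_coprime (n : ℕ) : (7 ^ (n + 1) * F.d - 1).Coprime (7 * F.d) :=
  ((Nat.coprime_self_sub_left (F.one_lt_level n).le).mpr (Nat.coprime_one_left _)).coprime_dvd_right ⟨7 ^ n, by ring⟩

/-- `mₙ − 1 ≡ −1` modulo `|D|`. [cite: Lang1990, Ch. 10 §1 (PDF p. 167)] -/
theorem natCast_level_sub_one_zmod_d (n : ℕ) : ((7 ^ (n + 1) * F.d - 1 : ℕ) : ZMod F.d) = -1 := by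
  rw [Nat.cast_sub (F.one_lt_level n).le, Nat.cast_mul, ZMod.natCast_self, mul_zero, Nat.cast_one, zero_sub]

/-- `mₙ − 1 ≡ −1` modulo `7`. [cite: Lang1990, Ch. 10 §1 (PDF p. 167)] -/
theorem natCast_level_sub_one_zmod_seven (n : ℕ) : ((7 ^ (n + 1) * F.d - 1 : ℕ) : ZMod 7) = -1 := by
  rw [Nat.cast_sub (F.one_lt_level n).le, Nat.cast_mul, Nat.cast_pow, show ((7 : ℕ) : ZMod 7) = 0 from ZMod.natCast_self 7,
    zero_pow (Nat.succ_ne_zero n), zero_mul, Nat.cast_one, zero_sub]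

/-- **The reading of complex conjugation is trivial**: `χ_D(mₙ − 1)·ω(mₙ − 1)⁵ = χ_D(−1)ω(−1)⁵ = 1` (`η₁` is even).
[cite: Lang1990, Ch. 10 §2 (PDF p. 171, «θ = even character»)] [cite: Tsuji1999, §3 (p. 6, «χ even»)] -/
theorem reading_level_sub_one (n : ℕ) :
    F.χD (((7 ^ (n + 1) * F.d - 1 : ℕ)) : ZMod F.d) * F.ω (((7 ^ (n + 1) * F.d - 1 : ℕ)) : ZMod 7) ^ 5 = 1 := by
  rw [F.natCast_level_sub_one_zmod_d, F.natCast_level_sub_one_zmod_seven, F.χD_neg_one, F.omega_neg_one]; norm_num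

/-- **`γ₀^{r_n(mₙ−1)}` acts trivially on `F′ₙ` at the `Λ`-level**: `(1+T)^{r_n(mₙ−1)} ≡ 1 (mod h_n)`
(`u^{r}·ω(−1) ≡ −1` forces `u^{r} ≡ 1 (mod 7^{n+1})`, so `7ⁿ ∣ r`). [cite: Lang1990, Ch. 10 §1 Thm 1.2 (PDF p. 168)] -/
theorem one_add_X_pow_r_level_sub_one_sub_one_mem (n : ℕ) :
    ((1 + X : IwasawaAlgebra 7) ^ F.r n (7 ^ (n + 1) * F.d - 1) - 1) ∈ Ideal.span {layerModulus 7 n} := by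
  haveI : Fact (Nat.Prime 7) := ⟨Nat.prime_seven⟩
  have hcop7 : (7 ^ (n + 1) * F.d - 1).Coprime 7 := (F.level_sub_one_coprime n).coprime_mul_right_right
  have ha := F.r_logTable n _ hcop7
  have hb : (F.u : ℤ_[7]) ^ 0 * F.ω (((7 ^ (n + 1) * F.d - 1 : ℕ)) : ZMod 7) - ((7 ^ (n + 1) * F.d - 1 : ℕ) : ℤ_[7]) ∈
      Ideal.span {((7 : ℕ) : ℤ_[7]) ^ (n + 1)} := by
    rw [pow_zero, one_mul, F.natCast_level_sub_one_zmod_seven, F.omega_neg_one, Nat.cast_sub (F.one_lt_level n).le,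
      Nat.cast_one, show (-1 : ℤ_[7]) - (((7 ^ (n + 1) * F.d : ℕ) : ℤ_[7]) - 1) = -(((7 ^ (n + 1) * F.d : ℕ) : ℤ_[7])) from by ring,
      Ideal.neg_mem_iff, Ideal.mem_span_singleton]
    exact ⟨(F.d : ℤ_[7]), by push_cast; ring⟩
  have h := one_add_X_pow_sub_pow_mem_of_congr (p := 7) (by decide) F.u_topGenerator
    (isUnit_apply_natCast_of_coprime F.ω hcop7) ha hb
  rwa [pow_zero] at h

set_option maxHeartbeats 400000 in
/-- ★ **THE PUSHED TWISTED UNIT DIES AT LEVEL `n`.**  For a genus datum `d` over `(F, θu)`, a transport `(σ, T)` (`T g = σ_g|_{F′ₙ}`),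
a complex conjugation `c`, integer exponents `Y`, the CORE IDENTITY of (A6-2) `wₙ·c(wₙ) = 1` (`wₙ = θₙ²·∏ᶠ_h (h ξₙ)^{Σ_{T g = h} Y g}`),
and elements `υ_g·γ₀^{r_n(ḡ)}`, `υ_c·γ₀^{r_n(mₙ−1)}` of `Υ·γ₀^ℕ` agreeing with `σ_g`, `c` on `F′ₙ` (E1's lifts): the element
`V = 2·(48θraw) + Σ_g Y(g)·υ_g(1+T)^{r_n(ḡ)}(48ξraw)` of `𝓤` satisfies `rep n (V + υ_c(1+T)^{r_n(mₙ−1)} V) = 1` — its level-`n`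
projection is `(wₙ·c(wₙ))^{48} = 1` (E2 `rep_act_one_add_X_pow_smul_eq_of_agree`; §1 `finprod_zpow_finsum_fiber_eq_prod`).
[cite: Tsuji1999, §3 (pp. 5–6), §6 (p. 20)] [cite: Kato2004Asterisque, §15.5 (15.5.1) (p. 253)] -/
theorem rep_pushedTwistedUnit_eq_one {θu : ∀ n : ℕ, globalUnitsOf (F.layer n)} (d : GenusDatum F θu) (n : ℕ)
    [NeZero (7 ^ (n + 1) * F.d)] (c : AlgebraicClosure ℚ ≃ₐ[ℚ] AlgebraicClosure ℚ)
    (σ : (ZMod (7 ^ (n + 1) * F.d))ˣ → (AlgebraicClosure ℚ ≃ₐ[ℚ] AlgebraicClosure ℚ))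
    (T : (ZMod (7 ^ (n + 1) * F.d))ˣ →* (F.layer n ≃ₐ[ℚ] F.layer n))
    (hT : ∀ (g : (ZMod (7 ^ (n + 1) * F.d))ˣ) (x : F.layer n), ((T g x : F.layer n) : AlgebraicClosure ℚ) = σ g x)
    (Y : (ZMod (7 ^ (n + 1) * F.d))ˣ → ℤ)
    (hcore : ((((toFieldUnits (F.layer n) (θu n) : (F.layer n : Type)ˣ) : F.layer n) ^ 2 *
            ∏ᶠ h : F.layer n ≃ₐ[ℚ] F.layer n,
              (h ((toFieldUnits (F.layer n) (d.ξu n) : (F.layer n : Type)ˣ) : F.layer n)) ^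
              (∑ᶠ (g : (ZMod (7 ^ (n + 1) * F.d))ˣ) (_ : T g = h), Y g) : F.layer n) : AlgebraicClosure ℚ) *
        c ((((toFieldUnits (F.layer n) (θu n) : (F.layer n : Type)ˣ) : F.layer n) ^ 2 *
            ∏ᶠ h : F.layer n ≃ₐ[ℚ] F.layer n,
              (h ((toFieldUnits (F.layer n) (d.ξu n) : (F.layer n : Type)ˣ) : F.layer n)) ^
              (∑ᶠ (g : (ZMod (7 ^ (n + 1) * F.d))ˣ) (_ : T g = h), Y g) : F.layer n) : AlgebraicClosure ℚ) = 1)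
    (υ : (ZMod (7 ^ (n + 1) * F.d))ˣ → torsionCyclotomicSubgroup 7)
    (hυσ : ∀ (g : (ZMod (7 ^ (n + 1) * F.d))ˣ) (x : AlgebraicClosure ℚ), x ∈ F.layer n →
      ((υ g : absoluteGaloisGroup ℚ) * F.γ₀ ^ F.r n ((g : ZMod (7 ^ (n + 1) * F.d))).val) • x =
        ((absoluteGaloisGroup.toAlgEquiv ℚ).symm (σ g)) • x)
    (υc : torsionCyclotomicSubgroup 7) {jc : ℕ}
    (hυcσ : ∀ x : AlgebraicClosure ℚ, x ∈ F.layer n →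
      ((υc : absoluteGaloisGroup ℚ) * F.γ₀ ^ jc) • x = ((absoluteGaloisGroup.toAlgEquiv ℚ).symm c) • x) :
    F.U.rep n
      (((2 : ℕ) • ((48 : ℕ) • d.θraw) + ∑ g : (ZMod (7 ^ (n + 1) * F.d))ˣ,
        (Y g) • F.U.act (υ g) ((1 + X : IwasawaAlgebra 7) ^ F.r n ((g : ZMod (7 ^ (n + 1) * F.d))).val • ((48 : ℕ) • d.ξraw))) +
        F.U.act υc ((1 + X : IwasawaAlgebra 7) ^ jc •
          ((2 : ℕ) • ((48 : ℕ) • d.θraw) + ∑ g : (ZMod (7 ^ (n + 1) * F.d))ˣ,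
        (Y g) • F.U.act (υ g) ((1 + X : IwasawaAlgebra 7) ^ F.r n ((g : ZMod (7 ^ (n + 1) * F.d))).val • ((48 : ℕ) • d.ξraw))))) = 1 := by
  haveI : Fact (Nat.Prime 7) := ⟨Nat.prime_seven⟩
  haveI : FiniteDimensional ℚ (F.layer n) := F.finiteDimensional_layer n
  -- the pushed element `V` and the global unit `U` with `rep n V = glob(U)^48`
  obtain ⟨U, hU⟩ : ∃ U : globalUnitsOf (F.layer n), U = θu n ^ 2 * ∏ g : (ZMod (7 ^ (n + 1) * F.d))ˣ,
      (⟨galUnits ((absoluteGaloisGroup.toAlgEquiv ℚ).symm (σ g)) (d.ξu n : (AlgebraicClosure ℚ)ˣ),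
        @galUnits_mem_globalUnitsOf ℚ _ (F.layer n) (F.normal_layer n) _ (d.ξu n)⟩ : globalUnitsOf (F.layer n)) ^ Y g :=
    ⟨_, rfl⟩
  obtain ⟨V, hV⟩ : ∃ V : F.U.M, V = ((2 : ℕ) • ((48 : ℕ) • d.θraw) + ∑ g : (ZMod (7 ^ (n + 1) * F.d))ˣ,
        (Y g) • F.U.act (υ g) ((1 + X : IwasawaAlgebra 7) ^ F.r n ((g : ZMod (7 ^ (n + 1) * F.d))).val • ((48 : ℕ) • d.ξraw))) :=
    ⟨_, rfl⟩
  rw [← hV]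
  have hrepV : F.U.rep n V = globalToSemilocalUnits F.v (F.layer n) U ^ 48 := by
    have hg : ∀ g : (ZMod (7 ^ (n + 1) * F.d))ˣ,
        F.U.rep n ((Y g) • F.U.act (υ g) ((1 + X : IwasawaAlgebra 7) ^ F.r n ((g : ZMod (7 ^ (n + 1) * F.d))).val •
          ((48 : ℕ) • d.ξraw))) =
          (globalToSemilocalUnits F.v (F.layer n)
            ⟨galUnits ((absoluteGaloisGroup.toAlgEquiv ℚ).symm (σ g)) (d.ξu n : (AlgebraicClosure ℚ)ˣ),
              @galUnits_mem_globalUnitsOf ℚ _ (F.layer n) (F.normal_layer n) _ (d.ξu n)⟩ ^ 48) ^ Y g := by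
      intro g
      rw [F.rep_zsmul]
      exact congrArg (· ^ Y g) (F.rep_act_one_add_X_pow_smul_eq_of_agree (υ g) n _ (hυσ g) (d.ξraw_rep n))
    rw [hV, F.U.rep_add, F.rep_nsmul, d.θraw_rep n, F.rep_sum, Finset.prod_congr rfl (fun g _ => hg g), hU]
    exact (pow_sq_mul_prod_pow_zpow (globalToSemilocalUnits F.v (F.layer n) (θu n))
      (fun g : (ZMod (7 ^ (n + 1) * F.d))ˣ => globalToSemilocalUnits F.v (F.layer n)
        ⟨galUnits ((absoluteGaloisGroup.toAlgEquiv ℚ).symm (σ g)) (d.ξu n : (AlgebraicClosure ℚ)ˣ),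
          @galUnits_mem_globalUnitsOf ℚ _ (F.layer n) (F.normal_layer n) _ (d.ξu n)⟩) Y 48).trans
      (congrArg (· ^ 48) (map_sq_mul_prod_zpow (globalToSemilocalUnits F.v (F.layer n)) (θu n)
        (fun g : (ZMod (7 ^ (n + 1) * F.d))ˣ =>
          (⟨galUnits ((absoluteGaloisGroup.toAlgEquiv ℚ).symm (σ g)) (d.ξu n : (AlgebraicClosure ℚ)ˣ),
            @galUnits_mem_globalUnitsOf ℚ _ (F.layer n) (F.normal_layer n) _ (d.ξu n)⟩ : globalUnitsOf (F.layer n))) Y).symm)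
  -- `(U : ℚ̄)` is (A6-2)'s `wₙ`
  have hξ0 : ∀ h : F.layer n ≃ₐ[ℚ] F.layer n,
      (h ((toFieldUnits (F.layer n) (d.ξu n) : (F.layer n : Type)ˣ) : F.layer n) : F.layer n) ≠ 0 := fun h =>
    (map_ne_zero_iff _ h.injective).mpr (toFieldUnits (F.layer n) (d.ξu n)).ne_zero
  have hUE : (((U : globalUnitsOf (F.layer n)) : (AlgebraicClosure ℚ)ˣ) : AlgebraicClosure ℚ) =
      ((((toFieldUnits (F.layer n) (θu n) : (F.layer n : Type)ˣ) : F.layer n) ^ 2 *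
          ∏ᶠ h : F.layer n ≃ₐ[ℚ] F.layer n,
            (h ((toFieldUnits (F.layer n) (d.ξu n) : (F.layer n : Type)ˣ) : F.layer n)) ^
            (∑ᶠ (g : (ZMod (7 ^ (n + 1) * F.d))ˣ) (_ : T g = h), Y g) : F.layer n) : AlgebraicClosure ℚ) := by
    classical
    rw [finprod_zpow_finsum_fiber_eq_prod T _ hξ0 Y, hU]
    -- left: push the coercions `globalUnitsOf F′ₙ → ℚ̄ˣ → ℚ̄`
    rw [Subgroup.coe_mul, Subgroup.coe_pow, Subgroup.val_finsetProd, Units.val_mul, Units.val_pow_eq_pow_val, Units.coe_prod]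
    simp_rw [Subgroup.coe_zpow, Units.val_zpow_eq_zpow_val, coe_galUnits, toAlgEquiv_symm_smul]
    -- right: push the coercion `F′ₙ → ℚ̄`
    rw [IntermediateField.coe_mul, IntermediateField.coe_pow, IntermediateField.coe_prod]
    simp_rw [coe_zpow_intermediateField, hT, coe_coe_toFieldUnits]
  -- add the `c`-translate; the product is killed at level `n`
  have hUc : U * ⟨galUnits ((absoluteGaloisGroup.toAlgEquiv ℚ).symm c) (U : (AlgebraicClosure ℚ)ˣ),
      @galUnits_mem_globalUnitsOf ℚ _ (F.layer n) (F.normal_layer n) _ U⟩ = 1 := by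
    apply Subtype.ext
    apply Units.ext
    rw [Subgroup.coe_mul, Units.val_mul, Subgroup.coe_one, Units.val_one, coe_galUnits, toAlgEquiv_symm_smul, hUE]
    exact hcore
  have hprod : globalToSemilocalUnits F.v (F.layer n) U ^ 48 *
      globalToSemilocalUnits F.v (F.layer n) ⟨galUnits ((absoluteGaloisGroup.toAlgEquiv ℚ).symm c)
        (U : (AlgebraicClosure ℚ)ˣ), @galUnits_mem_globalUnitsOf ℚ _ (F.layer n) (F.normal_layer n) _ U⟩ ^ 48 = 1 := by
    rw [← mul_pow, ← map_mul, hUc, map_one, one_pow]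
  rw [F.U.rep_add]
  exact (congrArg₂ (· * ·) hrepV (F.rep_act_one_add_X_pow_smul_eq_of_agree υc n _ hυcσ hrepV)).trans hprod

/-- **`e_{η₁}` of the pushed element**: with E1's readings `η₁(υ_g) = χ_D(ḡ)ω(ḡ)⁵`,
`e(2·(48θraw) + Σ_g Y(g)·υ_g(1+T)^{r_n(ḡ)}(48ξraw)) = 48·(2·e_{η₁}θ + (Σ_g C(Y g)·R_n(ḡ))·e_{η₁}ξ)`
(E2 `apply_act_one_add_X_pow_smul_of_eq`). [cite: Tsuji1999, §2 Lemma 2.1 (pp. 3–4), §4 (p. 12)] -/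
theorem apply_pushedElement_eq {θu : ∀ n : ℕ, globalUnitsOf (F.layer n)} (d : GenusDatum F θu) (n : ℕ)
    [NeZero (7 ^ (n + 1) * F.d)] (Y : (ZMod (7 ^ (n + 1) * F.d))ˣ → ℤ)
    (υ : (ZMod (7 ^ (n + 1) * F.d))ˣ → torsionCyclotomicSubgroup 7)
    (hυη : ∀ g : (ZMod (7 ^ (n + 1) * F.d))ˣ, ((F.η₁ (υ g) : ℤ_[7]ˣ) : ℤ_[7]) =
      F.χD ((((g : ZMod (7 ^ (n + 1) * F.d))).val : ℕ) : ZMod F.d) *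
        F.ω ((((g : ZMod (7 ^ (n + 1) * F.d))).val : ℕ) : ZMod 7) ^ 5)
    (R : ℕ → IwasawaAlgebra 7)
    (hR : ∀ a : ℕ, R a = C (F.χD (a : ZMod F.d) * F.ω (a : ZMod 7) ^ 5) * (1 + X) ^ F.r n a) :
    d.e ((2 : ℕ) • ((48 : ℕ) • d.θraw) + ∑ g : (ZMod (7 ^ (n + 1) * F.d))ˣ,
        (Y g) • F.U.act (υ g) ((1 + X : IwasawaAlgebra 7) ^ F.r n ((g : ZMod (7 ^ (n + 1) * F.d))).val • ((48 : ℕ) • d.ξraw))) =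
      ((48 : ℕ) : IwasawaAlgebra 7) • ((2 : IwasawaAlgebra 7) • (d.θ : F.U.M) +
        (∑ g : (ZMod (7 ^ (n + 1) * F.d))ˣ, C (((Y g : ℤ) : ℤ_[7])) * R ((g : ZMod (7 ^ (n + 1) * F.d))).val) •
          (d.ξ : F.U.M)) := by
  have he := d.e_isChiProjector
  have hg : ∀ g : (ZMod (7 ^ (n + 1) * F.d))ˣ,
      d.e ((Y g) • F.U.act (υ g) ((1 + X : IwasawaAlgebra 7) ^ F.r n ((g : ZMod (7 ^ (n + 1) * F.d))).val •
        ((48 : ℕ) • d.ξraw))) =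
        ((((Y g : ℤ) : IwasawaAlgebra 7) *
            (C (F.χD ((((g : ZMod (7 ^ (n + 1) * F.d))).val : ℕ) : ZMod F.d) *
                F.ω ((((g : ZMod (7 ^ (n + 1) * F.d))).val : ℕ) : ZMod 7) ^ 5) *
              (1 + X : IwasawaAlgebra 7) ^ F.r n ((g : ZMod (7 ^ (n + 1) * F.d))).val) * ((48 : ℕ) : IwasawaAlgebra 7))) •
          (d.ξ : F.U.M) := by
    intro g
    rw [map_zsmul d.e (Y g), F.apply_act_one_add_X_pow_smul_of_eq he (hυη g) (F.r n ((g : ZMod (7 ^ (n + 1) * F.d))).val)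
      ((48 : ℕ) • d.ξraw), map_nsmul d.e 48 d.ξraw, ← d.ξ_eq]
    exact zsmul_smul_nsmul_eq _ _ _ _
  have hPsum : (∑ g : (ZMod (7 ^ (n + 1) * F.d))ˣ, ((Y g : ℤ) : IwasawaAlgebra 7) *
      (C (F.χD ((((g : ZMod (7 ^ (n + 1) * F.d))).val : ℕ) : ZMod F.d) *
            F.ω ((((g : ZMod (7 ^ (n + 1) * F.d))).val : ℕ) : ZMod 7) ^ 5) *
          (1 + X : IwasawaAlgebra 7) ^ F.r n ((g : ZMod (7 ^ (n + 1) * F.d))).val) * ((48 : ℕ) : IwasawaAlgebra 7)) =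
      ((48 : ℕ) : IwasawaAlgebra 7) *
        ∑ g : (ZMod (7 ^ (n + 1) * F.d))ˣ, C (((Y g : ℤ) : ℤ_[7])) * R ((g : ZMod (7 ^ (n + 1) * F.d))).val := by
    rw [Finset.mul_sum]
    refine Finset.sum_congr rfl fun g _ => ?_
    rw [hR ((g : ZMod (7 ^ (n + 1) * F.d))).val, map_intCast (C : ℤ_[7] →+* IwasawaAlgebra 7) (Y g)]
    ring
  have heθ : d.e ((2 : ℕ) • ((48 : ℕ) • d.θraw)) =
      ((2 : IwasawaAlgebra 7) * ((48 : ℕ) : IwasawaAlgebra 7)) • (d.θ : F.U.M) := by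
    rw [map_nsmul d.e 2, map_nsmul d.e 48 d.θraw, ← d.θ_eq]
    exact (nsmul_nsmul_eq (R := IwasawaAlgebra 7) 2 48 _).trans (by rw [Nat.cast_ofNat])
  have heξ : d.e (∑ g : (ZMod (7 ^ (n + 1) * F.d))ˣ,
      (Y g) • F.U.act (υ g) ((1 + X : IwasawaAlgebra 7) ^ F.r n ((g : ZMod (7 ^ (n + 1) * F.d))).val • ((48 : ℕ) • d.ξraw))) =
      (((48 : ℕ) : IwasawaAlgebra 7) *
        ∑ g : (ZMod (7 ^ (n + 1) * F.d))ˣ, C (((Y g : ℤ) : ℤ_[7])) * R ((g : ZMod (7 ^ (n + 1) * F.d))).val) • (d.ξ : F.U.M) := by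
    rw [map_sum d.e, Finset.sum_congr rfl (fun g _ => hg g), ← Finset.sum_smul, hPsum]
  rw [map_add d.e, heθ, heξ, smul_add, smul_smul, smul_smul, mul_comm (2 : IwasawaAlgebra 7)]

end GenusFrame

end Summit.BirchSwinnertonDyer.Rank1Residual.Additive.GenusSeven

end
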